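import Literature.AlgebraicGeometry.Motives.Cycles
import Mathlib.RingTheory.Ideal.KrullsHeightTheorem
import Mathlib.RingTheory.KrullDimension.NonZeroDivisors
import Mathlib.RingTheory.NoetherNormalization
import Mathlib.RingTheory.IntegralClosure.GoingDown
import Mathlib.RingTheory.Ideal.GoingUp
import Mathlib.RingTheory.Polynomial.UniqueFactorization
import Mathlib.RingTheory.Polynomial.RationalRoot
import Mathlib.RingTheory.Spectrum.Prime.Noetherian
import Mathlib.Order.KrullDimension
import Literature.AlgebraicGeometry.Motives.VarietiesDimensionProofs
import Literature.RingTheory.KrullDimension.AffineDimension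
import HarnessLib

/-!
# Codimension versus dimension of points; discharge of `Literature.AlgebraicGeometry.Motives.cyclesOfCodim_eq_cyclesOfDim`

`Literature.AlgebraicGeometry.Motives.Cycles` records as a named fact
(`Literature.cyclesOfCodim_eq_cyclesOfDim : Prop`) that on a smooth projective, geometrically irreducible
variety `X` of dimension `n` over a field `k` the codimension-`p` cycles are exactly the
dimension-`d` cycles whenever `p + d = n` (`Z^p X = Z_d X`), citing Hartshorne II Ex. 3.20; the
relevant item of that exercise is (d), `dim Y + codim(Y, X) = dim X` for closed (irreducible)
`Y` in an integral scheme of finite type over a field, which Hartshorne derives from the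
dimension theory of affine domains, I Thm. 1.8A (b): `height 𝔭 + dim B/𝔭 = dim B`. This file
proves the fact (`Literature.AlgebraicGeometry.Motives.cyclesOfCodim_eq_cyclesOfDim_holds`), sorry-free, in two parts.

## Part 1. The dimension formula for affine domains (Hartshorne I.1.8A (b))

The classical dimension theory of finitely generated algebras over a field that Mathlib
(v4.32.0) does not yet have beyond `dim K[X₁,…,Xₙ] = n` and Noether normalization, on top of
the invariance of Krull dimension under injective integral extensions
(`Literature.RingTheory.KrullDimension.ringKrullDim_eq_of_isIntegral`, `Literature/RingTheory/KrullDimension/AffineDimension.lean`;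
Görtz–Wedhorn I, Thm. B.56):

* `Literature.AlgebraicGeometry.Motives.MvPolynomial.ringKrullDim_quotient_span_singleton`: a hypersurface `V(g) ⊂ 𝔸ⁿ⁺¹`
  (`g` nonzero, non-unit) has dimension `n` (Görtz–Wedhorn I, Thm. 5.32 with Prop. 5.30 and
  Cor. 5.18; Hartshorne I, Prop. 1.13), from Krull's principal ideal theorem and the height of
  maximal ideals of polynomial rings (`Literature.AlgebraicGeometry.Motives.MvPolynomial.height_eq_of_isMaximal`).
* `Literature.AlgebraicGeometry.Motives.ringKrullDim_quotient_of_height_eq_one`: for an affine domain `A` of dimension `n + 1`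
  and a prime `Q` of height one, `dim A/Q = n` — by Noether normalization
  (Mathlib `exists_integral_inj_algHom_of_fg`), going down over the integrally closed polynomial
  ring (Mathlib's instance in `RingTheory/IntegralClosure/GoingDown`, Görtz–Wedhorn I,
  Thm. B.56 (3)), principality of height-one primes of a UFD, and the hypersurface case.
* `Literature.AlgebraicGeometry.Motives.height_add_coheight_eq_of_isDomain`: **Hartshorne I, Thm. 1.8A (b)** — in an affine
  domain `A` of dimension `n`, `height 𝔭 + dim A/𝔭 = n` for every prime `𝔭`, stated on the
  prime spectrum as `height x + coheight x = n` (equivalently: all maximal chains of primes have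
  length `n`, Görtz–Wedhorn I, Thm. 5.19 / Prop. 5.30 (1)); proved by induction on `n` using the
  previous result. The printed form is `Literature.AlgebraicGeometry.Motives.Ideal.height_add_ringKrullDim_quotient`.
* `Literature.AlgebraicGeometry.Motives.height_add_coheight_eq_of_isPrime_nilradical`,
  `Literature.AlgebraicGeometry.Motives.height_add_coheight_eq_of_isStandardSmoothOfRelativeDimension`: the same for finitely
  generated algebras with irreducible spectrum, in particular for standard smooth algebras of
  relative dimension `n` over a field with irreducible spectrum (whose dimension is `n`,
  `Literature.AlgebraicGeometry.Motives.ringKrullDim_eq_of_isStandardSmoothOfRelativeDimension`, Görtz–Wedhorn I, Lemma 6.26).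

## Part 2. Smooth schemes over a field and the discharge

* `Literature.AlgebraicGeometry.Motives.height_add_coheight_eq_of_smoothOfRelativeDimension`: if `X → Spec K` is smooth of
  relative dimension `n` and `X` is irreducible, then every point `z ∈ X` satisfies
  `height z + coheight z = n` in the specialisation order (Mathlib: `height z = dim closure {z}`,
  `coheight z = dim 𝒪_{X,z}`), i.e. `dim {z}⁻ + codim({z}⁻, X) = dim X`
  (Hartshorne II Ex. 3.20 (d); Görtz–Wedhorn I Prop. 5.30 (2)).
  Proof: `≤` holds in the `n`-dimensional poset `X`
  (`Literature.AlgebraicGeometry.Motives.krullDim_eq_of_smoothOfRelativeDimension`, from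
  `Literature.AlgebraicGeometry.Motives.topologicalKrullDim_eq_of_smoothOfRelativeDimension`). For `≥`, an affine chart
  `Spec S → X` at `z` with `S` standard smooth of relative dimension `n` over `K`
  (`Literature.AlgebraicGeometry.Motives.exists_isStandardSmoothOfRelativeDimension_of_field`) is irreducible, so
  `height + coheight = n` on `Spec S` by Part 1; the open immersion preserves coheights
  (Mathlib `AlgebraicGeometry.coheight_eq_of_isOpenImmersion`) and does not lower heights.
* `Literature.cyclesOfCodim_eq_cyclesOfDim_holds : Literature.cyclesOfCodim_eq_cyclesOfDim`. Projectivity is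
  not used; geometric irreducibility only supplies irreducibility of `X`.

## References

* R. Hartshorne, *Algebraic Geometry*, GTM 52, Springer (1977), doi:10.1007/978-1-4757-3849-0:
  I Thm. 1.8A ("(b) For any prime ideal 𝔭 in B, we have height 𝔭 + dim B/𝔭 = dim B"; the
  proof is referred to Matsumura, *Commutative Algebra*, Ch. 5 §14, and Atiyah–Macdonald,
  Ch. 11), I Prop. 1.13 (hypersurfaces in `𝔸ⁿ`), II Ex. 3.20 (a), (d) ("If Y is a closed subset
  of X, then dim Y + codim(Y,X) = dim X"), (e) (dimension of integral schemes of finite type over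
  a field). [Hartshorne1977]
* U. Görtz, T. Wedhorn, *Algebraic Geometry I: Schemes*, 2nd ed., Springer Spektrum (2020),
  doi:10.1007/978-3-658-30733-2: Prop. 5.12 and Thm. B.56 (integral extensions: incomparability,
  going up, going down, `dim A = dim B`), Thm. 5.19, Thm. 5.22 and Prop. 5.30 (maximal chains in
  affine domains; `dim Y + codim_X Y = dim X`), Thm. 5.32 (hypersurfaces), Lemma 6.26.
  [GortzWedhorn2020]
-/

universe u

open Ideal

namespace Literature.AlgebraicGeometry.Motives

/-! ### Hypersurfaces in affine space -/

section Hypersurface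

variable (K : Type*) [Field K]

/-- **A hypersurface in `𝔸ⁿ⁺¹` has dimension `n`** (Görtz–Wedhorn I, Thm. 5.32 for
`X = 𝔸ⁿ⁺¹`: `V(g)` is equi-codimensional of codimension one, with Prop. 5.30 (2) and
Cor. 5.18; cf. Hartshorne I, Prop. 1.13): for a nonzero non-unit `g ∈ K[X₀,…,Xₙ]`,
`dim K[X₀,…,Xₙ]/(g) = n`. Proof: `≤` since `g` is a non-zero-divisor (Mathlib
`ringKrullDim_quotient_succ_le_of_nonZeroDivisor`, `ENat.WithBot.add_le_add_one_right_iff`);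
`≥` because a maximal ideal `M ⊇ (g)` has height `n + 1`
(`Literature.AlgebraicGeometry.Motives.MvPolynomial.height_eq_of_isMaximal`) and `ht M ≤ ht (M/(g)) + 1` (Krull's principal
ideal theorem, Mathlib `Ideal.height_le_height_add_one_of_mem`).
[cite: GortzWedhorn2020, Thm. 5.32 with Prop. 5.30 (2)] -/
theorem MvPolynomial.ringKrullDim_quotient_span_singleton (n : ℕ)
    {g : MvPolynomial (Fin (n + 1)) K} (hg0 : g ≠ 0) (hgu : ¬ IsUnit g) :
    ringKrullDim (MvPolynomial (Fin (n + 1)) K ⧸ Ideal.span {g}) = n := by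
  have hdim : ringKrullDim (MvPolynomial (Fin (n + 1)) K) = (n + 1 : ℕ) := by
    rw [MvPolynomial.ringKrullDim_of_isNoetherianRing, ringKrullDim_eq_zero_of_field]
    simp
  apply le_antisymm
  · refine ENat.WithBot.add_le_add_one_right_iff.mp ?_
    have := ringKrullDim_quotient_succ_le_of_nonZeroDivisor (mem_nonZeroDivisors_of_ne_zero hg0)
    rw [hdim] at this
    exact_mod_cast this
  · have hne : Ideal.span {g} ≠ ⊤ := by rwa [Ne, Ideal.span_singleton_eq_top]
    obtain ⟨M, hM, hgM⟩ := Ideal.exists_le_maximal _ hne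
    have hgM' : g ∈ M := hgM (Ideal.mem_span_singleton_self g)
    have h1 : M.height ≤ (M.map (Ideal.Quotient.mk (Ideal.span {g}))).height + 1 :=
      Ideal.height_le_height_add_one_of_mem hgM'
    rw [MvPolynomial.height_eq_of_isMaximal K (n + 1) M] at h1
    have h1' : (n : ℕ∞) ≤ (M.map (Ideal.Quotient.mk (Ideal.span {g}))).height :=
      (WithTop.add_le_add_iff_right WithTop.one_ne_top).mp (by exact_mod_cast h1)
    haveI : (M.map (Ideal.Quotient.mk (Ideal.span {g}))).IsPrime :=
      Ideal.map_isPrime_of_surjective Ideal.Quotient.mk_surjective (by rwa [Ideal.mk_ker])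
    have h2 := Ideal.height_le_ringKrullDim_of_ne_top
      (this : (M.map (Ideal.Quotient.mk (Ideal.span {g}))).IsPrime).ne_top
    calc (n : WithBot ℕ∞)
        ≤ ((M.map (Ideal.Quotient.mk (Ideal.span {g}))).height : WithBot ℕ∞) := by
          exact_mod_cast h1'
      _ ≤ _ := h2

end Hypersurface

/-! ### Affine domains: `height 𝔭 + dim A/𝔭 = dim A` -/

section AffineDomain

variable (K : Type*) [Field K]

/-- **Key step of Hartshorne I.1.8A (b)**: in a finitely generated domain `A` over a field `K`
with `dim A = n + 1`, the quotient by a prime `Q` of height one has dimension `n`. Proof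
(Görtz–Wedhorn I, proofs of Thm. 5.19 and Thm. 5.32): by Noether normalization (Mathlib
`exists_integral_inj_algHom_of_fg`) `A` is integral over a polynomial ring
`R = K[X₀,…,Xₙ] ⊆ A`; the contraction `𝔮 = Q ∩ R` is generated by a prime element `x`
(a nonzero prime of the UFD `R` contains a prime element, and `(x) ⊊ 𝔮` would, by going down
for the integrally closed `R` — Mathlib's instance from `RingTheory/IntegralClosure/GoingDown` —
produce a nonzero prime strictly below the height-one prime `Q`); hence
`dim A/Q = dim R/(x) = n` by invariance of dimension under the integral injective extension
`R/(x) ↪ A/Q` (`Literature.RingTheory.KrullDimension.ringKrullDim_eq_of_isIntegral`) and the hypersurface case.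
[cite: Hartshorne1977, I Thm. 1.8A (b)] -/
theorem ringKrullDim_quotient_of_height_eq_one (A : Type u) [CommRing A] [IsDomain A]
    [Algebra K A] [Algebra.FiniteType K A] {n : ℕ} (hA : ringKrullDim A = (n + 1 : ℕ))
    (Q : Ideal A) [Q.IsPrime] (hQ : Q.height = 1) :
    ringKrullDim (A ⧸ Q) = n := by
  -- Noether normalization `R = K[X₁, …, Xₛ] ↪ A`, integral and injective
  obtain ⟨s, g, hg_inj, hg_int⟩ := exists_integral_inj_algHom_of_fg K A
  haveI : IsNoetherianRing A := Algebra.FiniteType.isNoetherianRing K A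
  have hRdim : ringKrullDim (MvPolynomial (Fin s) K) = s := by
    rw [MvPolynomial.ringKrullDim_of_isNoetherianRing, ringKrullDim_eq_zero_of_field]
    simp
  letI : Algebra (MvPolynomial (Fin s) K) A := g.toRingHom.toAlgebra
  haveI : Algebra.IsIntegral (MvPolynomial (Fin s) K) A := ⟨fun a => hg_int a⟩
  have hinj : Function.Injective (algebraMap (MvPolynomial (Fin s) K) A) := hg_inj
  haveI : FaithfulSMul (MvPolynomial (Fin s) K) A :=
    (faithfulSMul_iff_algebraMap_injective _ A).mpr hinj
  -- `s = n + 1`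
  have hsn : (s : WithBot ℕ∞) = (n + 1 : ℕ) := by
    rw [← hRdim, ← hA]
    exact Literature.RingTheory.KrullDimension.ringKrullDim_eq_of_isIntegral hinj
  have hs : s = n + 1 := by exact_mod_cast hsn
  subst hs
  set R := MvPolynomial (Fin (n + 1)) K
  -- the contraction `𝔮 = Q ∩ R` is a nonzero prime, generated by a prime element `x`
  set q : Ideal R := Q.under R with hq
  haveI : Q.LiesOver q := ⟨rfl⟩
  have hQne : Q ≠ ⊥ := by
    rintro rfl
    rw [Ideal.height_bot] at hQ
    exact zero_ne_one hQ
  have hqne : q ≠ ⊥ := Ideal.under_ne_bot R hQne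
  obtain ⟨x, hxq, hx⟩ := Ideal.IsPrime.exists_mem_prime_of_ne_bot inferInstance hqne
  have hx0 : x ≠ 0 := hx.ne_zero
  haveI hxprime : (Ideal.span {x}).IsPrime := (Ideal.span_singleton_prime hx0).mpr hx
  have hqx : q = Ideal.span {x} := by
    by_contra hne
    have hlt : Ideal.span {x} < q :=
      lt_of_le_of_ne ((Ideal.span_singleton_le_iff_mem _).mpr hxq) (Ne.symm hne)
    -- going down: a prime `P < Q` of `A` over `(x)`; but `Q` has height one, so `P = ⊥`
    obtain ⟨P, hPQ, hP, hPover⟩ := Ideal.exists_ideal_lt_liesOver_of_lt Q hlt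
    have hPh : P.height < 1 := hQ ▸ Ideal.height_strict_mono_of_isPrime_of_isPrime hPQ
    have hP0 : P.height = 0 := Order.lt_one_iff.mp hPh
    have hPbot : P = ⊥ := by
      have hmin := Ideal.height_eq_zero_iff.mp hP0
      rwa [IsDomain.minimalPrimes_eq_singleton_bot, Set.mem_singleton_iff] at hmin
    have hxbot : Ideal.span {x} = ⊥ := by
      rw [hPover.over, hPbot, Ideal.under_def]
      exact Ideal.comap_bot_of_injective (algebraMap R A) hinj
    exact hx0 (Ideal.span_singleton_eq_bot.mp hxbot)
  -- `dim R/𝔮 = n` (hypersurface) and `dim A/Q = dim R/𝔮` (integral injective extension)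
  have hRq : ringKrullDim (R ⧸ q) = n := by
    rw [hqx]
    exact MvPolynomial.ringKrullDim_quotient_span_singleton K n hx0 hx.not_unit
  have hinj' : Function.Injective (algebraMap (R ⧸ q) (A ⧸ Q)) :=
    (faithfulSMul_iff_algebraMap_injective (R ⧸ q) (A ⧸ Q)).mp inferInstance
  have hAQ : ringKrullDim (A ⧸ Q) = ringKrullDim (R ⧸ q) :=
    (Literature.RingTheory.KrullDimension.ringKrullDim_eq_of_isIntegral hinj').symm
  rw [hAQ, hRq]

end AffineDomain

/-! ### Two order-theoretic lemmas -/

section Order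

variable {α : Type*}

/-- In an upper set, coheights are computed in the ambient order. [folklore] -/
lemma coheight_coe_eq_of_isUpperSet [Preorder α] {s : Set α} (hs : IsUpperSet s) (z : s) :
    Order.coheight (z : α) = Order.coheight z :=
  (Order.coheight_eq_of_strictMono (Subtype.val : s → α) (Subtype.strictMono_coe s) (fun a b h =>
    ⟨⟨b, hs h.le a.2⟩, h, rfl⟩) z).symm

/-- If `⊥ < y ≤ x`, a chain of length `m` below `x` inside `[y, ∞)` extends by `⊥` to a chain
of length `m + 1` below `x`: `height_{[y,∞)} x + 1 ≤ height x`. [folklore] -/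
lemma height_Ici_add_one_le [PartialOrder α] [OrderBot α] {y x : α} (hy : ⊥ < y) (hx : y ≤ x)
    {m : ℕ} (hm : Order.height (⟨x, hx⟩ : Set.Ici y) = m) :
    (m : ℕ∞) + 1 ≤ Order.height x := by
  obtain ⟨p, hlast, hlen⟩ := Order.exists_series_of_height_eq_coe _ hm
  let p' : LTSeries α := p.map Subtype.val (Subtype.strictMono_coe _)
  have hhead : ⊥ < p'.head := by
    rw [LTSeries.head_map]
    exact lt_of_lt_of_le hy p.head.2
  have hlast' : (p'.cons ⊥ hhead).last = x := by
    rw [RelSeries.last_cons, LTSeries.last_map, hlast]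
  calc (m : ℕ∞) + 1 = ((p'.cons ⊥ hhead).length : ℕ∞) := by
        rw [RelSeries.cons_length, LTSeries.map_length, hlen]; push_cast; rfl
    _ ≤ Order.height (p'.cons ⊥ hhead).last := Order.length_le_height_last
    _ = Order.height x := by rw [hlast']

end Order

/-! ### Affine domains: `height x + coheight x = dim A` on the prime spectrum -/

section AffineDomainOrder

variable (K : Type*) [Field K]

/-- **Hartshorne I.1.8A (b) / Görtz–Wedhorn I Prop. 5.30**, prime-spectrum form: in a finitely
generated domain `A` of dimension `n` over a field, every prime `𝔭` satisfies
`height 𝔭 + dim A/𝔭 = n`, i.e. `height x + coheight x = n` for every point `x` of `Spec A`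
(all maximal chains of primes through `𝔭` have length `n`). Proof by induction on `n`: for
`𝔭 ≠ 0` choose a height-one prime `Q ⊆ 𝔭`; `A/Q` is an affine domain of dimension `n - 1`
(`ringKrullDim_quotient_of_height_eq_one`), `Spec (A/Q) ≅ V(Q) ⊆ Spec A` preserves coheights and
`height_{V(Q)} 𝔭 + 1 ≤ height 𝔭`, so the induction hypothesis gives
`height 𝔭 + coheight 𝔭 ≥ n`; `≤` holds in any poset of dimension `n`.
[cite: Hartshorne1977, I Thm. 1.8A (b)] -/
theorem height_add_coheight_eq_of_isDomain (n : ℕ) :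
    ∀ (A : Type u) [CommRing A] [IsDomain A] [Algebra K A] [Algebra.FiniteType K A],
      ringKrullDim A = n → ∀ x : PrimeSpectrum A, Order.height x + Order.coheight x = n := by
  induction n with
  | zero =>
    intro A _ _ _ _ hA x
    have h1 : (Order.height x : WithBot ℕ∞) ≤ (0 : ℕ) := hA ▸ Order.height_le_krullDim x
    have h2 : (Order.coheight x : WithBot ℕ∞) ≤ (0 : ℕ) :=
      hA ▸ Order.coheight_le_krullDim x
    have h1' : Order.height x = 0 := nonpos_iff_eq_zero.mp (by exact_mod_cast h1)
    have h2' : Order.coheight x = 0 := nonpos_iff_eq_zero.mp (by exact_mod_cast h2)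
    rw [h1', h2']
    rfl
  | succ n ih =>
    intro A _ _ _ _ hA x
    haveI : IsNoetherianRing A := Algebra.FiniteType.isNoetherianRing K A
    -- upper bound, valid in every poset of dimension `n + 1`
    have hle : Order.height x + Order.coheight x ≤ (n + 1 : ℕ) := by
      have h := Order.krullDim_eq_iSup_height_add_coheight_of_nonempty (α := PrimeSpectrum A)
      have h' : (⨆ a : PrimeSpectrum A, Order.height a + Order.coheight a) = (n + 1 : ℕ) := by
        have h'' : ((⨆ a : PrimeSpectrum A, Order.height a + Order.coheight a : ℕ∞) :
            WithBot ℕ∞) = (n + 1 : ℕ) := by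
          rw [← h]; exact hA
        exact_mod_cast h''
      rw [← h']
      exact le_iSup (fun a : PrimeSpectrum A => Order.height a + Order.coheight a) x
    refine le_antisymm hle ?_
    by_cases hx0 : Order.height x = 0
    · -- `x` is the generic point `(0)`
      have hxbot : x = ⊥ := (Order.height_eq_zero.mp hx0).eq_bot
      subst hxbot
      have h : (Order.coheight (⊥ : PrimeSpectrum A) : WithBot ℕ∞) = (n + 1 : ℕ) := by
        rw [Order.coheight_bot_eq_krullDim]; exact hA
      have h' : Order.coheight (⊥ : PrimeSpectrum A) = (n + 1 : ℕ) := by exact_mod_cast h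
      rw [h', hx0, zero_add]
    · -- choose `y ≤ x` of height one
      have hxfin : Order.height x < ⊤ :=
        lt_of_le_of_lt (le_trans le_self_add hle) (ENat.coe_lt_top _)
      obtain ⟨y, hyx, hy⟩ : ∃ y ≤ x, Order.height y = 1 := by
        by_cases h1 : Order.height x = 1
        · exact ⟨x, le_rfl, h1⟩
        · have h1' : ((1 : ℕ) : ℕ∞) < Order.height x :=
            lt_of_le_of_ne (by exact_mod_cast Order.one_le_iff_ne_zero.mpr hx0) (Ne.symm h1)
          obtain ⟨y, hyx, hy⟩ := (Order.coe_lt_height_iff hxfin).mp h1'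
          exact ⟨y, hyx.le, by exact_mod_cast hy⟩
      have hybot : ⊥ < y := by
        rw [bot_lt_iff_ne_bot]
        rintro rfl
        simp at hy
      have hQ : y.asIdeal.height = 1 := by rw [PrimeSpectrum.height_eq_orderHeight, hy]
      -- `A / Q` is an affine domain of dimension `n`
      have hA' : ringKrullDim (A ⧸ y.asIdeal) = n :=
        ringKrullDim_quotient_of_height_eq_one K A hA y.asIdeal hQ
      -- transport along `Spec (A/Q) ≃o V(Q) = [y, ∞) ⊆ Spec A`
      let e := Ideal.primeSpectrumQuotientOrderIsoZeroLocus y.asIdeal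
      have hxmem : x ∈ PrimeSpectrum.zeroLocus (y.asIdeal : Set A) := by
        simpa [PrimeSpectrum.mem_zeroLocus, SetLike.coe_subset_coe] using hyx
      set z : PrimeSpectrum.zeroLocus (y.asIdeal : Set A) := ⟨x, hxmem⟩ with hz
      have hIH := ih (A ⧸ y.asIdeal) hA' (e.symm z)
      rw [Order.height_orderIso, Order.coheight_orderIso] at hIH
      -- coheights agree, heights drop by at least one
      have hupper : IsUpperSet (PrimeSpectrum.zeroLocus (y.asIdeal : Set A)) := by
        intro a b hab ha
        simp only [PrimeSpectrum.mem_zeroLocus, SetLike.coe_subset_coe] at ha ⊢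
        exact le_trans ha hab
      have hco : Order.coheight z = Order.coheight x :=
        (coheight_coe_eq_of_isUpperSet hupper z).symm
      have hzfin : Order.height z < ⊤ :=
        lt_of_le_of_lt (le_trans le_self_add hIH.le) (ENat.coe_lt_top _)
      obtain ⟨m, hm⟩ := ENat.ne_top_iff_exists.mp hzfin.ne
      have hxm : (m : ℕ∞) + 1 ≤ Order.height x := by
        have hzeq : Set.Ici y = PrimeSpectrum.zeroLocus (y.asIdeal : Set A) := by
          ext a
          simp [PrimeSpectrum.mem_zeroLocus, SetLike.coe_subset_coe]
        have hm' : Order.height (⟨x, hyx⟩ : Set.Ici y) = m := by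
          rw [← Order.height_orderIso (OrderIso.setCongr _ _ hzeq) ⟨x, hyx⟩]
          exact hm.symm
        exact height_Ici_add_one_le hybot hyx hm'
      rw [← hm, hco] at hIH
      -- `n = m + coheight x` and `m + 1 ≤ height x`
      calc ((n + 1 : ℕ) : ℕ∞) = (m + Order.coheight x) + 1 := by rw [hIH]; push_cast; rfl
        _ = (m + 1) + Order.coheight x := by
          rw [add_assoc, add_comm (Order.coheight x) 1, ← add_assoc]
        _ ≤ Order.height x + Order.coheight x := by gcongr

/-- `height x + coheight x = dim S` on `Spec S` for a finitely generated algebra `S` over a field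
whose spectrum is irreducible (nilradical prime): `Spec S_red ≅ Spec S` as ordered sets and
`S_red = S/nil S` is an affine domain (Hartshorne I.1.8A (b), II Ex. 3.20 (d); Görtz–Wedhorn I
Prop. 5.30 for affine `X`). [cite: Hartshorne1977, I Thm. 1.8A (b)] -/
theorem height_add_coheight_eq_of_isPrime_nilradical (S : Type u) [CommRing S] [Algebra K S]
    [Algebra.FiniteType K S] (hS : (nilradical S).IsPrime) {n : ℕ} (hdim : ringKrullDim S = n)
    (y : PrimeSpectrum S) : Order.height y + Order.coheight y = n := by
  haveI : IsDomain (S ⧸ nilradical S) := (Ideal.Quotient.isDomain_iff_prime _).mpr hS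
  have hz : PrimeSpectrum.zeroLocus ((nilradical S : Ideal S) : Set S) = Set.univ := by
    ext p
    simp only [PrimeSpectrum.mem_zeroLocus, SetLike.coe_subset_coe, Set.mem_univ, iff_true]
    exact nilradical_le_prime p.asIdeal
  let e : PrimeSpectrum (S ⧸ nilradical S) ≃o PrimeSpectrum S :=
    (Ideal.primeSpectrumQuotientOrderIsoZeroLocus (nilradical S)).trans
      ((OrderIso.setCongr _ _ hz).trans OrderIso.Set.univ)
  have hdim' : ringKrullDim (S ⧸ nilradical S) = n := by
    rw [ringKrullDim, Order.krullDim_eq_of_orderIso e, ← ringKrullDim, hdim]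
  have h := height_add_coheight_eq_of_isDomain K n (S ⧸ nilradical S) hdim' (e.symm y)
  rwa [← Order.height_orderIso e, ← Order.coheight_orderIso e, e.apply_symm_apply] at h

/-- **Smooth algebras.** For a standard smooth algebra `S` of relative dimension `n` over a field
with irreducible spectrum, every point `y` of `Spec S` has `height y + coheight y = n`
(`dim S = n` by `Literature.AlgebraicGeometry.Motives.ringKrullDim_eq_of_isStandardSmoothOfRelativeDimension`, Görtz–Wedhorn I
Lemma 6.26, and the dimension formula for affine algebras, Hartshorne I.1.8A (b)).
[cite: Hartshorne1977, I Thm. 1.8A (b)] [cite: GortzWedhorn2020, Prop. 5.30] -/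
theorem height_add_coheight_eq_of_isStandardSmoothOfRelativeDimension (n : ℕ) (S : Type u)
    [CommRing S] [Algebra K S] [Algebra.IsStandardSmoothOfRelativeDimension n K S]
    (hS : (nilradical S).IsPrime) (y : PrimeSpectrum S) :
    Order.height y + Order.coheight y = n := by
  haveI : Nontrivial S := by
    refine ⟨⟨1, 0, fun h => hS.ne_top ((Ideal.eq_top_iff_one _).mpr ?_)⟩⟩
    rw [h]
    exact zero_mem _
  haveI : Algebra.IsStandardSmooth K S :=
    Algebra.IsStandardSmoothOfRelativeDimension.isStandardSmooth n
  exact height_add_coheight_eq_of_isPrime_nilradical K S hS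
    (ringKrullDim_eq_of_isStandardSmoothOfRelativeDimension K n) y

/-- The Krull dimension of a finitely generated algebra over a field is finite: it is a natural
number (`dim A = d` for a finite injective `K[T₁,…,T_d] ↪ A`, Görtz–Wedhorn I, Cor. 5.17).
[cite: GortzWedhorn2020, Cor. 5.17] -/
theorem exists_ringKrullDim_eq_natCast (A : Type u) [CommRing A] [Nontrivial A] [Algebra K A]
    [Algebra.FiniteType K A] : ∃ d : ℕ, ringKrullDim A = d := by
  obtain ⟨s, g, hg_inj, hg_int⟩ := exists_integral_inj_algHom_of_fg K A
  letI : Algebra (MvPolynomial (Fin s) K) A := g.toRingHom.toAlgebra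
  haveI : Algebra.IsIntegral (MvPolynomial (Fin s) K) A := ⟨fun a => hg_int a⟩
  have hinj : Function.Injective (algebraMap (MvPolynomial (Fin s) K) A) := hg_inj
  refine ⟨s, ?_⟩
  rw [← Literature.RingTheory.KrullDimension.ringKrullDim_eq_of_isIntegral hinj, MvPolynomial.ringKrullDim_of_isNoetherianRing,
    ringKrullDim_eq_zero_of_field]
  simp

/-- **Hartshorne I, Thm. 1.8A (b)**, as printed: for a finitely generated domain `B` over a
field and any prime ideal `𝔭 ⊂ B`, `height 𝔭 + dim B/𝔭 = dim B`.
[cite: Hartshorne1977, I Thm. 1.8A (b)] -/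
theorem Ideal.height_add_ringKrullDim_quotient (B : Type u) [CommRing B] [IsDomain B]
    [Algebra K B] [Algebra.FiniteType K B] (P : Ideal B) [hP : P.IsPrime] :
    (P.height : WithBot ℕ∞) + ringKrullDim (B ⧸ P) = ringKrullDim B := by
  obtain ⟨d, hd⟩ := exists_ringKrullDim_eq_natCast K B
  let x : PrimeSpectrum B := ⟨P, hP⟩
  have h := height_add_coheight_eq_of_isDomain K d B hd x
  have hzl : PrimeSpectrum.zeroLocus (P : Set B) = Set.Ici x := by
    ext a
    simp [PrimeSpectrum.mem_zeroLocus, SetLike.coe_subset_coe, x,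
      ← PrimeSpectrum.asIdeal_le_asIdeal]
  have h1 : (P.height : WithBot ℕ∞) = Order.height x := by
    rw [show P = x.asIdeal from rfl, PrimeSpectrum.height_eq_orderHeight]
  have h2 : ringKrullDim (B ⧸ P) = Order.coheight x := by
    rw [ringKrullDim_quotient, Order.krullDim_eq_of_orderIso (OrderIso.setCongr _ _ hzl),
      Order.coheight_eq_krullDim_Ici]
  rw [h1, h2, hd, ← WithBot.coe_add, h]
  rfl

end AffineDomainOrder

/-! ## Part 2: smooth schemes over a field; discharge of `Literature.AlgebraicGeometry.Motives.cyclesOfCodim_eq_cyclesOfDim` -/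

open CategoryTheory _root_.AlgebraicGeometry Order TopologicalSpace

section Scheme

variable {K : Type u} [Field K] {X : Scheme.{u}} (f : X ⟶ Spec (CommRingCat.of K)) (n : ℕ)

/-- The specialisation order of a non-empty scheme smooth of relative dimension `n` over a field
has Krull dimension `n` (order-theoretic form of
`Literature.AlgebraicGeometry.Motives.topologicalKrullDim_eq_of_smoothOfRelativeDimension`: closed irreducible subsets of the
sober space `X` correspond to points; Görtz–Wedhorn I, Lemma 6.26 with Lemma 5.7 (4)).
[cite: GortzWedhorn2020, Lemma 6.26 and Lemma 5.7 (4)] -/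
theorem krullDim_eq_of_smoothOfRelativeDimension [SmoothOfRelativeDimension n f] [Nonempty X] :
    Order.krullDim X = n := by
  rw [← Order.krullDim_eq_of_orderIso (irreducibleSetEquivPoints (α := X))]
  exact topologicalKrullDim_eq_of_smoothOfRelativeDimension f n

/-- Open immersions are strictly monotone for the specialisation orders. [folklore] -/
lemma strictMono_base_of_isOpenImmersion {U : Scheme.{u}} (g : U ⟶ X) [IsOpenImmersion g] :
    StrictMono (fun a : U => g.base a) := by
  intro a b hab
  simp only [lt_iff_le_not_ge, Scheme.le_iff_specializes] at hab ⊢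
  rwa [g.isOpenEmbedding.isInducing.specializes_iff, g.isOpenEmbedding.isInducing.specializes_iff]

/-- **`dim {z}⁻ + codim {z}⁻ = n` on smooth irreducible schemes over a field** (Hartshorne II
Ex. 3.20 (d) for smooth `X`; Görtz–Wedhorn I Prop. 5.30 (2)): if `f : X → Spec K` is smooth of
relative dimension `n` and `X` is irreducible, every point `z` has
`height z + coheight z = n` in the specialisation order (`height z = dim closure {z}`,
`coheight z = dim 𝒪_{X,z}`). Proof: `≤` from `dim X = n`; for `≥` take an affine chart
`Spec S ∋ z` with `S` standard smooth of relative dimension `n` over `K` (irreducible, being open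
in `X`), where `height + coheight = n` holds by the affine dimension formula
(`Literature.AlgebraicGeometry.Motives.height_add_coheight_eq_of_isStandardSmoothOfRelativeDimension`); the open immersion
`Spec S → X` preserves coheights (Mathlib `coheight_eq_of_isOpenImmersion`) and does not decrease
heights. [cite: Hartshorne1977, II Ex. 3.20 (d)] [cite: GortzWedhorn2020, Prop. 5.30 (2)] -/
theorem height_add_coheight_eq_of_smoothOfRelativeDimension [SmoothOfRelativeDimension n f]
    [IrreducibleSpace X] (z : X) : Order.height z + Order.coheight z = n := by
  -- upper bound from `dim X = n`
  have hle : Order.height z + Order.coheight z ≤ n := by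
    have h := Order.krullDim_eq_iSup_height_add_coheight_of_nonempty (α := X)
    rw [krullDim_eq_of_smoothOfRelativeDimension f n] at h
    have h' : (⨆ a : X, Order.height a + Order.coheight a) = n := by exact_mod_cast h.symm
    rw [← h']
    exact le_iSup (fun a : X => Order.height a + Order.coheight a) z
  refine le_antisymm hle ?_
  -- an affine chart `Spec S → X` at `z`, `S = Γ(X, V)` standard smooth of relative dimension `n`
  obtain ⟨V, hV, hzV, φ, hφ⟩ := exists_isStandardSmoothOfRelativeDimension_of_field f n z
  algebraize [φ]
  obtain ⟨y, hy⟩ : z ∈ Set.range hV.fromSpec.base := by rw [hV.range_fromSpec]; exact hzV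
  haveI : Nonempty (Spec Γ(X, V)) := ⟨y⟩
  haveI : IrreducibleSpace (Spec Γ(X, V)) := hV.fromSpec.isOpenEmbedding.irreducibleSpace
  have hnil : (nilradical Γ(X, V)).IsPrime :=
    PrimeSpectrum.irreducibleSpace_iff_isPrime_nilradical.mp ‹_›
  -- on `Spec S` (whose specialisation order is dual to the inclusion order of primes)
  have hy' : Order.height y + Order.coheight y = n := by
    have h := height_add_coheight_eq_of_isStandardSmoothOfRelativeDimension K n Γ(X, V) hnil
      (OrderDual.ofDual (specOrderIsoPrimeSpectrum Γ(X, V) y))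
    have e1 : Order.height y =
        Order.coheight (OrderDual.ofDual (specOrderIsoPrimeSpectrum Γ(X, V) y)) := by
      rw [← Order.height_orderIso (specOrderIsoPrimeSpectrum Γ(X, V)) y, ← Order.height_toDual,
        OrderDual.toDual_ofDual]
    have e2 : Order.coheight y =
        Order.height (OrderDual.ofDual (specOrderIsoPrimeSpectrum Γ(X, V) y)) := by
      rw [← Order.coheight_orderIso (specOrderIsoPrimeSpectrum Γ(X, V)) y,
        ← Order.coheight_toDual, OrderDual.toDual_ofDual]
    rw [e1, e2, add_comm]
    exact h
  -- transfer along the open immersion `Spec S → X`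
  have hco : Order.coheight z = Order.coheight y := by
    rw [← hy]
    exact coheight_eq_of_isOpenImmersion hV.fromSpec
  have hht : Order.height y ≤ Order.height z := by
    rw [← hy]
    exact Order.height_le_height_apply_of_strictMono _
      (strictMono_base_of_isOpenImmersion hV.fromSpec) y
  calc (n : ℕ∞) = Order.height y + Order.coheight y := hy'.symm
    _ ≤ Order.height z + Order.coheight z := by rw [hco]; gcongr

end Scheme

/-! ### Discharge of `Literature.AlgebraicGeometry.Motives.cyclesOfCodim_eq_cyclesOfDim` -/

/-- **Discharge of the named fact `Literature.AlgebraicGeometry.Motives.cyclesOfCodim_eq_cyclesOfDim`** (Hartshorne II Ex. 3.20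
(d): `dim Y + codim(Y, X) = dim X` for closed irreducible `Y` in an integral scheme of finite
type over a field; here the smooth projective, geometrically irreducible case). On a smooth
projective variety `X` of dimension `n` over `k`, a point `z` has codimension `p` iff it has
dimension `d` whenever `p + d = n`, because `height z + coheight z = n`
(`Literature.AlgebraicGeometry.Motives.height_add_coheight_eq_of_smoothOfRelativeDimension`: `X → Spec k` is smooth of relative
dimension `n` and `X` is irreducible, being geometrically irreducible over the point; projectivity
is not used); hence `Z^p X = Z_d X`. [cite: Hartshorne1977, II Ex. 3.20 (d)] -/
theorem cyclesOfCodim_eq_cyclesOfDim_holds : cyclesOfCodim_eq_cyclesOfDim.{u} := by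
  intro k _ n X hX p d hpd
  haveI := hX.smoothOfRelativeDimension
  haveI := hX.geometricallyIrreducible
  haveI : IrreducibleSpace X.left :=
    GeometricallyIrreducible.irreducibleSpace_of_subsingleton X.hom
  have key : ∀ z : X.left, Order.coheight z = p ↔ Order.height z = d := by
    intro z
    have h := height_add_coheight_eq_of_smoothOfRelativeDimension X.hom n z
    rw [← hpd, Nat.cast_add] at h
    constructor
    · intro hc
      rw [hc, add_comm] at h
      exact WithTop.add_left_cancel (ENat.coe_ne_top p) h
    · intro hh
      rw [hh, add_comm (p : ℕ∞) d] at h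
      exact WithTop.add_left_cancel (ENat.coe_ne_top d) h
  ext c
  exact forall_congr' fun z => imp_congr_right fun _ => key z

end Literature.AlgebraicGeometry.Motives
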